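import Mathlib

/-!
# 'Split at p is automatic' — the representation-theoretic step of the K-theory dictionary

Part II §7.11 (16.12)(j)(i) of the residency paper (CLAIMS c208): for a cell field `F` and
`K = F(ζ_p)`, the primes of `K` above `p` are `Δ = Gal(K/F)`-invariant, so their classes lie in
the `Δ`-invariants of `Cl(K)/p`; a class-group character in a NON-trivial isotypic component
`[ω^j]`, `j ≢ 0`, therefore vanishes on them, i.e. the corresponding unramified `ℤ/p`-extension is
split at every prime above `p`.  Consequently `Ш¹(G_{F,S}, 𝔽_p(ω^j)) = Hom((Cl(K)/p)[ω^j], 𝔽_p)`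
and the 'split at `p`' clause of THEOREM D (D1) is automatic.  The load-bearing algebra is the
lemma below: an equivariant functional with non-trivial character kills invariant vectors (and,
more generally, vectors on which some group element with `χ g ≠ 1` acts trivially).
-/

namespace Summit.Langlands.Langlands.Theorems

/-- An equivariant functional `φ(ρ_g v) = χ(g) φ(v)` with `χ g ≠ 1` vanishes on every vector fixed
by `g`. -/
theorem soloInformed_equivariant_functional_kills_fixed
    {k V G : Type*} [Field k] [AddCommGroup V] [Module k V]
    (ρ : G → V →ₗ[k] V) (χ : G → k) (φ : V →ₗ[k] k)
    (hφ : ∀ g v, φ (ρ g v) = χ g * φ v)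
    (g : G) (hg : χ g ≠ 1) (v : V) (hv : ρ g v = v) : φ v = 0 := by
  have h := hφ g v
  rw [hv] at h
  -- h : φ v = χ g * φ v
  have h' : (χ g - 1) * φ v = 0 := by
    have := h
    linear_combination -this
  rcases mul_eq_zero.mp h' with h1 | h2
  · exact absurd (sub_eq_zero.mp h1) hg
  · exact h2

/-- The same for a vector fixed by the whole group: if some `g` has `χ g ≠ 1` (the character is
non-trivial), every invariant vector is killed. -/
theorem soloInformed_equivariant_functional_kills_invariants
    {k V G : Type*} [Field k] [AddCommGroup V] [Module k V]
    (ρ : G → V →ₗ[k] V) (χ : G → k) (φ : V →ₗ[k] k)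
    (hφ : ∀ g v, φ (ρ g v) = χ g * φ v)
    (hχ : ∃ g, χ g ≠ 1) (v : V) (hv : ∀ g, ρ g v = v) : φ v = 0 := by
  obtain ⟨g, hg⟩ := hχ
  exact soloInformed_equivariant_functional_kills_fixed ρ χ φ hφ g hg v (hv g)

/-- Dually: an eigenvector `ρ_g v = χ(g) v` with `χ g ≠ 1` is killed by every `g`-invariant
functional (`φ ∘ ρ_g = φ`) — the form in which it is used for Frobenius classes of invariant
primes paired against `[ω^j]`-characters. -/
theorem soloInformed_invariant_functional_kills_eigenvector
    {k V G : Type*} [Field k] [AddCommGroup V] [Module k V]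
    (ρ : G → V →ₗ[k] V) (χ : G → k) (φ : V →ₗ[k] k)
    (g : G) (hφ : ∀ v, φ (ρ g v) = φ v) (hg : χ g ≠ 1)
    (v : V) (hv : ρ g v = χ g • v) : φ v = 0 := by
  have h := hφ v
  rw [hv, map_smul, smul_eq_mul] at h
  -- h : χ g * φ v = φ v
  have h' : (χ g - 1) * φ v = 0 := by linear_combination h
  rcases mul_eq_zero.mp h' with h1 | h2
  · exact absurd (sub_eq_zero.mp h1) hg
  · exact h2

end Summit.Langlands.Langlands.Theorems
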